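import Literature.NumberTheory.EllipticCurves.ModularCurve
import HarnessLib
import HarnessLib.Audit.Tags

/-!
# Candidates E-an-45 / E-an-45′ / E-an-46 / E-an-46′ (an g11, MEMO-an §55): CUSP `3`-TORSION AND `3 ∣ deg φ` AT `4 ∥ N`
# — `CuspThreeTorsionAtFourExact`, `CuspImageThreeTorsion`, `ThreeDvdModularDegreeOfCuspImageZero`,
# `ThreeDvdModularDegreeAtFourExact` — cell `bsd-f2-manin` (D-0131 (3) frontier: the Manin constant at additive
# primes). `@[conjecture]` leaf: NOTHING asserted, four definitions, no edges (an's proved glue lands in the sibling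
# `CuspThreeTorsionAtFourEdges.lean`).

HONEST FRAMING. LENS = analytic / periods (planner `bsd-f2-manin-an` g11; HOME `run/shared/lean/pub/bsd-f2-manin/MEMO-an.md`
§55 «the level-four sign package `S₃ = ⟨w₄, S₂⟩` at `4 ∥ N`», §52 (the certified `S₃ ⊂ B(4M)`)). Source of the four
Props: HOME/an/Sketch-an-g11.lean sha16 3b526052f38cd08e (farm rc 0 · 0 errors · 0 sorries per an and per refuter-1
§R46), namespace `…Cruxes.ManinOddAtFour.LevelFourSign`, declarations copied VERBATIM into the cell's leaf namespace
(no helper to inline; binders `[NeZero (4 * M)]`, `Odd M` as an typed them — refuter-1 asked for no guards). Write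
`N = 4M`, `M` odd. The half-translate `S₂ = (1 ½; 0 1)` normalises `Γ₀(4M)` and with an Atkin–Lehner matrix `W₄`
generates `S₃ = GL₂(𝔽₂)` modulo `ℚˣ·Γ₀(4M)` (under `δ = diag(2,1)`: `Γ₀(4M) = δ⁻¹(Γ(2) ∩ Γ₀(M))δ`); a newform `f` of
level `4M` has `a_{2n} = 0`, so `f ∣ S₂ = −f`, and the 3-cycle `τ = W₄S₂` (cusp orbit `∞ ↦ [1/2M] ↦ [1/M] ↦ ∞`)
satisfies `f ∣ τ = f` (this uses the KNOWN sign `λ₄(f) = −1`, an's row E-an-44, typed by an only as a named hypothesis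
`AtkinLehnerSignAtFourExact` — NOT part of this leaf). Hence **E-an-45**: `φ ∘ τ = φ + P₄` with `P₄ = φ([1/M])`,
`3P₄ = O`, `φ([1/2M]) = −P₄` (c-free symbol form: `3·{∞,1/M}_f ∈ Λ_f`, `{∞,1/2M}_f + {∞,1/M}_f ∈ Λ_f`; the second
clause is HALF-TRANSLATE — tree `maninLocalTwoThree_modularSymbol_add_half_eq_neg_of_four_dvd` — plus
`Γ₀(N)`-equivalence of `1/M + ½` and `1/(2M)`); **E-an-46**: if `P₄ = O` then `φ` factors through the degree-`3`
quotient `X₀(4M) → X₀(4M)/⟨τ⟩`, so `3 ∣ deg φ`; **E-an-46′** (the census statement): `4 ∥ N` and no rational point of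
order `3` ⟹ `3 ∣ deg φ_D` for every `X₀(N)`-parametrisation datum. STATUS CLAIMED (MEMO-an §55.2–55.3; refuter-1
§R46, independent derivation: «E-an-45 by exact symbol calculus — f|₂τ = f ⟹ {τ∞, τr}_f = {∞, r}_f ⟹ {∞, τ³∞}_f =
3{∞, τ∞}_f ∈ Λ_f, τ∞ = x/M + ½, HALF-TRANSLATE ⟹ 3{∞,1/M}_f ∈ Λ_f — valid for every newform, rational or not;
NEWNESS is load-bearing; E-an-46 by FIBRE COUNTING on `deg_spec` (φ_D([1/M]) = 0 ⟹ φ_D τ-invariant; generic fibres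
τ-stable, fixed-point-free, of size deg ⟹ 3 ∣ deg) — no quotient curve needed in Lean; E-an-46′: φ_D is defined over
ℚ for EVERY datum, so the gap to 46′ is typing only»): THEOREM-candidates ×4, elementary; the sibling Edges file
carries an's proved glue 46 + «no rational 3-torsion ⟹ cusp image zero» ⟹ 46′ with the rationality hypothesis typed
as an implication (refuter-1 rb1). MANIN PLACEMENT (an §55.5, honest): Manin-neutral — NO new reduction of the crux
C2 `ManinOddAtFour` (stmt-BirchSwinnertonDyer-22967): at `4 ∥ N` the cotangent input is in print (Česnavičius–
Neururer–Saha) and `ord₂(c)` is the Lie-cokernel length (= E-imc-21); the `S₃`-orbit argument re-proves the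
cotangent statement on the Igusa components only. The rows are filed as the cell's beyond-print THEOREM-candidates
about `deg φ` / cusp images at `4 ∥ N` (they explain the unexplained surplus of `3 ∣ deg φ` observed by Watkins
2002 §4), not as Manin-constant laws.

NOT IN PRINT as statements (an presearch §55.7, corpus fts + vec AND galaxy; refuter-2 placement R-an-28 (b) NOT
posted at filing): nearest prior art BY NAME — Watkins 2002 §4 [corpus: paper:doi-10-1080-10586458-2002-10504701
pp. 13–14] (empirical surplus of `3 ∣ deg φ`, no mechanism); Byeon–Yhee 2011 [corpus: paper:doi-10-1016-j-jnt-2010-10-005]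
(rational torsion of odd prime order `ℓ ∤ N` on optimal curves via rational cuspidal divisors; no automorphism `τ`, no
degree statement); Calegari–Emerton 2009 (the prime `2`); Atkin–Lehner 1970 §4 / Akbas–Singerman / Bars (the
normaliser of `Γ₀(N)`, used for the sign only); Agashe–Ribet–Stein 2006 (modular degree vs congruence number).

BC5 WITNESS (cell census of record, RE-COUNTED by the typer 2026-08-28T05:3xZ with HOME/typer/bc5_count.py on
HOME/MANIN-ADDITIVE-CREMONA-TIER-v1.tsv.gz sha16 8d2f138f17175a2b, 984 410 rows = every Cremona class with `4 ∣ N` or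
`27 ∣ N`, `N < 5·10⁵`, optimal curve and `deg φ` from Cremona's tables): E-an-46′ — population `v₂(N) = 2 ∧ 3 ∤
#W(ℚ)_tors`: meets 158 257 · law `3 ∣ deg φ`: violations **0** · beyond-print 158 257 (no printed law predicts
`3 ∣ deg φ` here); contrapositive check `v₂(N) = 2 ∧ 3 ∤ deg φ`: 26 classes (20a1, 36a1, 44a1, 92a1, 116b1, 236b1,
404b1, 2636a1, …), ALL with `3 ∣ #W(ℚ)_tors` (violations 0); an's own run HOME/an/g11-s3-at-four.out cd55c2978af27079
agrees (T-E3: 158 257 / 26 / 6 775; controls: `v₂(N) = 3`: 33 398 classes with `3 ∤ #tors ∧ 3 ∤ deg`, `v₂(N) ≥ 4`: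
71 075 — the law is specific to `4 ∥ N`, as the mechanism says: `⟨S₂, w₈⟩ = D₄` has no element of order `3`).
E-an-45 (cusp images, an's CUSPIMG engine, `N ≤ 5000`): `ord φ([1/M]) ∈ {1: 1 458, 3: 17}`, nothing else;
`φ([1/2M]) = −φ([1/M])` at 1 475/1 475 (extension to `N ≤ 50 000` asked of -data, D-an-9, not run at filing).
REFUTER VERDICTS AT FILING (2026-08-28): REF1 §R46 (R-an-28 (a)): the package SURVIVES — E-an-44/45/45′/46/46′ all
THEOREM-candidates (44 a theorem), BC7 CLEAN ×4, KILLED 0 · misstated 0, A1 junk-data read consistent (`deg_spec` +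
`deg_pos` exclude `c = 0`; no optimality / `IsGloballyMinimal` needed); REF2 R-an-28 (b) placement PENDING. A
refuter-repaired text, if any, lands under a NEW name (suffix `R`) per the tree's append-only rule.
-/

set_option autoImplicit false

noncomputable section

open scoped MatrixGroups ModularForm

open CongruenceSubgroup WeierstrassCurve
  Literature.NumberTheory.EllipticCurves Literature.NumberTheory.EllipticCurves.ModularForms

namespace Summit.BirchSwinnertonDyer.Rank1Residual.ManinAdditive

/-- **Candidate E-an-45 `CuspThreeTorsionAtFourExact` (cell bsd-f2-manin, an g11; nothing asserted)** — c-free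
modular-symbol form. If `N = 4M` with `M` odd and `f` is a weight-`2` newform on `Γ₀(N)` with vanishing even
coefficients (`a_{2n}(f) = 0`, automatic for newforms at `4 ∣ N` but kept literal), then `3·{∞, 1/M}_f ∈ Λ_f` and
`{∞, 1/(2M)}_f + {∞, 1/M}_f ∈ Λ_f`: the optimal parametrisation sends the cusp `1/M` to a point `P₄` with `3P₄ = O`
and the cusp `1/(2M)` to `−P₄`. VERBATIM HOME/an/Sketch-an-g11.lean 3b526052f38cd08e `LevelFourSign.CuspThreeTorsionAtFourExact`.
Theorem-candidate (MEMO-an §55.2: the 3-cycle `τ = W₄S₂` of `X₀(4M)` fixes `f`; refuter-1 §R46 re-derived it by symbol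
calculus). Not in print as a statement (nearest: Byeon–Yhee 2011, odd `ℓ ∤ N`, cuspidal divisors, no `τ`).
[cite: ByeonYhee2011, Thm. 1.1 (shape only: rational torsion on optimal curves from rational cuspidal divisors; the level-`4M` cusp-`1/M` three-torsion law is NOT in print — cell memo MEMO-an §55)] -/
@[conjecture]
def CuspThreeTorsionAtFourExact : Prop :=
  ∀ {M : ℕ} [NeZero (4 * M)], Odd M → ∀ f : CuspForm (Gamma0 (4 * M)) 2, IsNewform0 f →
    (∀ n : ℕ, 2 ∣ n → cuspCoeff f n = 0) →
      3 * modularSymbol f (1 / (M : ℚ)) ∈ periodLattice f ∧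
        modularSymbol f (1 / (2 * M : ℚ)) + modularSymbol f (1 / (M : ℚ)) ∈ periodLattice f

/-- **Candidate E-an-45′ `CuspImageThreeTorsion` (cell bsd-f2-manin, an g11; nothing asserted)** — geometric form
for ANY `X₀(4M)`-parametrisation datum `D` of `W` (`M` odd): the image of the cusp `1/M` under
`φ_D = uniformize (c · {∞, ·}_f)` is killed by `3` in `W(ℂ)`. VERBATIM HOME/an/Sketch-an-g11.lean 3b526052f38cd08e
`LevelFourSign.CuspImageThreeTorsion`. Follows from E-an-45 via `D.smul_periodLattice_le` for any datum (refuter-1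
§R46 (4)). Theorem-candidate; not in print as a statement.
[cite: ByeonYhee2011, Thm. 1.1 (shape only: cusp images as rational torsion on optimal curves; the level-`4M` three-torsion form is NOT in print — cell memo MEMO-an §55)] -/
@[conjecture]
def CuspImageThreeTorsion : Prop :=
  ∀ (W : WeierstrassCurve ℚ) [W.IsElliptic] {M : ℕ} [NeZero (4 * M)], Odd M →
    ∀ D : ModularParametrizationData W (4 * M),
      3 • D.uniformize ((D.c : ℂ) * modularSymbol D.f (1 / (M : ℚ))) = 0

/-- **Candidate E-an-46 `ThreeDvdModularDegreeOfCuspImageZero` (cell bsd-f2-manin, an g11; nothing asserted).**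
`N = 4M`, `M` odd: for ANY parametrisation datum `D` of `W` by `X₀(4M)`, if the cusp `1/M` maps to `O` then
`3 ∣ deg φ_D` (the parametrisation is invariant under the fixed-point-free 3-cycle `τ = W₄S₂`, so it factors
through the degree-`3` cover `X₀(4M) → X₀(4M)/⟨τ⟩`; refuter-1 §R46 (5): fibre counting on `deg_spec`, no quotient
curve needed). VERBATIM HOME/an/Sketch-an-g11.lean 3b526052f38cd08e `LevelFourSign.ThreeDvdModularDegreeOfCuspImageZero`.
Theorem-candidate; not in print (Watkins 2002 §4 observes the surplus of `3 ∣ deg φ` without a mechanism).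
[cite: Watkins2002, §4 (shape only: the empirical surplus of `3 ∣ deg φ`; the level-`4M` mechanism and this statement are NOT in print — cell memo MEMO-an §55)] -/
@[conjecture]
def ThreeDvdModularDegreeOfCuspImageZero : Prop :=
  ∀ (W : WeierstrassCurve ℚ) [W.IsElliptic] {M : ℕ} [NeZero (4 * M)], Odd M →
    ∀ D : ModularParametrizationData W (4 * M),
      D.uniformize ((D.c : ℂ) * modularSymbol D.f (1 / (M : ℚ))) = 0 → 3 ∣ D.modularDegree

/-- **Candidate E-an-46′ `ThreeDvdModularDegreeAtFourExact` (cell bsd-f2-manin, an g11; nothing asserted)** —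
torsion form = the census statement: `4 ∥ N` (`N = 4M`, `M` odd) and `W(ℚ)` has no point of order `3` ⟹
`3 ∣ deg φ_D` for every `X₀(N)`-parametrisation datum `D` of `W`. VERBATIM HOME/an/Sketch-an-g11.lean
3b526052f38cd08e `LevelFourSign.ThreeDvdModularDegreeAtFourExact`. BC5: 158 257/158 257 optimal classes with
`v₂(N) = 2`, `3 ∤ #W(ℚ)_tors`, `N < 5·10⁵` have `3 ∣ deg φ` (violations 0; the 26 classes with `3 ∤ deg φ` all carry
a rational `3`-torsion point) — see the module docstring. Theorem-candidate (⟸ E-an-46 + E-an-45′ + rationality of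
the cusp image, sibling Edges file); not in print (explains Watkins 2002 §4).
[cite: Watkins2002, §4 (shape only: the empirical surplus of `3 ∣ deg φ`; this torsion-conditioned divisibility law at `4 ∥ N` is NOT in print — cell memo MEMO-an §55, census 158 257/0)] -/
@[conjecture]
def ThreeDvdModularDegreeAtFourExact : Prop :=
  ∀ (W : WeierstrassCurve ℚ) [W.IsElliptic] {M : ℕ} [NeZero (4 * M)], Odd M →
    (∀ P : W.toAffine.Point, 3 • P = 0 → P = 0) →
      ∀ D : ModularParametrizationData W (4 * M), 3 ∣ D.modularDegree

end Summit.BirchSwinnertonDyer.Rank1Residual.ManinAdditive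

end
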